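import Mathlib
import Summits.KontsevichZagierPeriods.Zeta5Search.CasoratianLawNoMultipole
import HarnessLib

/-!
# ζ(5) search — (CV) is a THEOREM at every window prime where `H(3)` holds

Cell `pub-zeta5` (HONEST FRAMING: systematic search; no irrationality claim unless certified), typer seat
generation 9.  Extends `CasoratianLawNoMultipole.lean`: at a window prime at which every multipole class has `3 + E_x ≥ 1`
(gen-2's hypothesis `H(3)`, `GoodClasses b p 3` — in particular whenever no class has two poles), EVERY row of the `𝒦`-bracket
carries the refund — single-pole rows by `singleRowLaw_holds`, multipole rows because `v(𝒦_x) ≥ 3 + E_x ≥ 1` for `b` and for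
`b + e_j` (`classExp_shift_ge`) while `v(V) ≥ −N_p` (THEOREM V) — so gen-2 g8's road gives (CV):

* `kBracket_bound_of_goodClasses`, `casoratianLaw_of_goodClasses : … → GoodClasses b p 3 → Cas_j(b) ≠ 0 → refund − N_p ≤ v_p(Cas_j(b))`.
The cancellation regime of (CV) is thus exactly `¬H(3)` (some multipole class with `E_x ≤ −3`).
`p`-adic valuations of rational numbers; nothing about irrationality.
-/

noncomputable section

open Finset

namespace Summit.KontsevichZagierPeriods.Zeta5Search.ClusterValuation

open Summit.KontsevichZagierPeriods.Zeta5Search.DualSeries (InBox)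
open Summit.KontsevichZagierPeriods.Zeta5Search.WedgeDictionary (coeffV dOf)
open Summit.KontsevichZagierPeriods.Zeta5Search.CasoratianValuation (InPolytope pairFloors refund shift casoratian)
open Summit.KontsevichZagierPeriods.Zeta5Search.PadicSeries

variable {p : ℕ} [hp : Fact p.Prime]

/-- Under `H(3)` every class piece `𝒦_x` (of `b` or of `b + e_j`) is divisible by `p`. -/
theorem padicNorm_classK_le_of_goodClasses (b : ℕ → ℤ) {j : ℕ} (hb : InPolytope b) (hj1 : 1 ≤ j)
    (hb' : InPolytope (shift b j)) (hp5 : 5 ≤ p) (hwin : (b 0 + 2 : ℤ) < (p : ℤ) ^ 2) (hgood : GoodClasses b p 3)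
    {x : ℕ} (hx : x < p) :
    padicNorm p (classK b p x) ≤ (p : ℚ) ^ (-(1 : ℤ)) ∧ padicNorm p (classK (shift b j) p x) ≤ (p : ℚ) ^ (-(1 : ℤ)) := by
  have hwin' : (shift b j 0 + 2 : ℤ) < (p : ℤ) ^ 2 := by rwa [BigPrime.shift_zero b hj1]
  have hcle := classPoleCount_shift_le b hb.1 hj1 p x
  have hEle := classExp_shift_ge b hb.1 hj1 p x
  constructor
  · rcases Nat.lt_trichotomy (classPoleCount b p x) 1 with hc | hc | hc
    · rw [classK_eq_zero_of_noPole b hb (by omega), padicNorm.zero]; exact zpow_p_nonneg _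
    · exact padicNorm_classK_le_single b hb hp5 hwin hx hc
    · have h1 := hgood x hx (by omega)
      push_cast at h1
      exact (padicNorm_classK_le_multi b hb hp5 hwin hx (by omega)).trans (zpow_le_zpow_right₀ one_le_p (by linarith))
  · rcases Nat.lt_trichotomy (classPoleCount (shift b j) p x) 1 with hc | hc | hc
    · rw [classK_eq_zero_of_noPole (shift b j) hb' (by omega), padicNorm.zero]; exact zpow_p_nonneg _
    · exact padicNorm_classK_le_single (shift b j) hb' hp5 hwin' hx hc
    · have h1 := hgood x hx (by omega)
      push_cast at h1
      exact (padicNorm_classK_le_multi (shift b j) hb' hp5 hwin' hx (by omega)).trans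
        (zpow_le_zpow_right₀ one_le_p (by linarith))

/-- **(CV-𝒦) under `H(3)`**: the whole `𝒦`-bracket carries the refund. -/
theorem kBracket_bound_of_goodClasses (b : ℕ → ℤ) {j : ℕ} (hb : InPolytope b) (hj1 : 1 ≤ j)
    (hb' : InPolytope (shift b j)) (hp5 : 5 ≤ p) (hwin : (b 0 + 2 : ℤ) < (p : ℤ) ^ 2) (hgood : GoodClasses b p 3)
    (hne : kRes (shift b j) p * coeffV b - kRes b p * coeffV (shift b j) ≠ 0) :
    1 - pairFloors b p ≤ padicValRat p (kRes (shift b j) p * coeffV b - kRes b p * coeffV (shift b j)) := by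
  have hp0 : 0 < p := hp.out.pos
  have hp1 : (1 : ℚ) < p := by exact_mod_cast hp.out.one_lt
  have hwin' : (shift b j 0 + 2 : ℤ) < (p : ℤ) ^ 2 := by rwa [BigPrime.shift_zero b hj1]
  have hN' : pairFloors (shift b j) p ≤ pairFloors b p := pairFloors_shift_le b hj1 p hp0
  have hV : padicNorm p (coeffV b) ≤ (p : ℚ) ^ pairFloors b p := padicNorm_coeffV_le_pairFloors b hb hp5 hwin
  have hV' : padicNorm p (coeffV (shift b j)) ≤ (p : ℚ) ^ pairFloors b p :=
    (padicNorm_coeffV_le_pairFloors (shift b j) hb' hp5 hwin').trans (zpow_le_zpow_right₀ hp1.le hN')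
  have hsplit : kRes (shift b j) p * coeffV b - kRes b p * coeffV (shift b j) =
      ∑ x ∈ range p, (classK (shift b j) p x * coeffV b - classK b p x * coeffV (shift b j)) := by
    rw [kRes_eq_sum_classK (shift b j) hp0, kRes_eq_sum_classK b hp0, sum_mul, sum_mul, ← sum_sub_distrib]
  apply val_ge_of_padicNorm_le hne
  rw [hsplit]
  refine padicNorm.sum_le' (fun x hx => ?_) (zpow_p_nonneg _)
  obtain ⟨hK, hK'⟩ := padicNorm_classK_le_of_goodClasses b hb hj1 hb' hp5 hwin hgood (mem_range.1 hx)
  have e : -(1 - pairFloors b p) = (-(1 : ℤ)) + pairFloors b p := by ring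
  rw [e]
  exact (padicNorm.sub (p := p)).trans (max_le (padicNorm_mul_le hK' hV) (padicNorm_mul_le hK hV'))

/-- **(CV) under `H(3)`** (gen-2 g8's road, pointwise; the cancellation regime of (CV) is exactly `¬H(3)`). -/
theorem casoratianLaw_of_goodClasses (b : ℕ → ℤ) {j : ℕ} (hb : InPolytope b) (hj1 : 1 ≤ j) (hj7 : j ≤ 7)
    (hb' : InPolytope (shift b j)) (hp5 : 5 ≤ p) (hwin : (b 0 + 2 : ℤ) < (p : ℤ) ^ 2) (hgood : GoodClasses b p 3)
    (hcas : casoratian b j ≠ 0) : refund b p - pairFloors b p ≤ padicValRat p (casoratian b j) := by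
  have hpp := hp.out
  have hp1 : (1 : ℚ) < p := by exact_mod_cast hpp.one_lt
  have hd0 : 0 ≤ dOf b := by
    have := hb.2.2; unfold dOf; linarith
  have hdshift : dOf (shift b j) = dOf b - 1 := BigPrime.dOf_shift b hj1 hj7
  have hN' : pairFloors (shift b j) p ≤ pairFloors b p := pairFloors_shift_le b hj1 p hpp.pos
  have hwin' : (shift b j 0 + 2 : ℤ) < (p : ℤ) ^ 2 := by rwa [BigPrime.shift_zero b hj1]
  have hVb : padicNorm p (coeffV b) ≤ (p : ℚ) ^ pairFloors b p := padicNorm_coeffV_le_pairFloors b hb hp5 hwin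
  have hVb' : padicNorm p (coeffV (shift b j)) ≤ (p : ℚ) ^ pairFloors b p :=
    (padicNorm_coeffV_le_pairFloors (shift b j) hb' hp5 hwin').trans (zpow_le_zpow_right₀ hp1.le hN')
  have hBb : padicNorm p (kRes (shift b j) p * coeffV b - kRes b p * coeffV (shift b j))
      ≤ (p : ℚ) ^ (-(1 - pairFloors b p)) :=
    padicNorm_le_of_val (fun h => kBracket_bound_of_goodClasses b hb hj1 hb' hp5 hwin hgood h)
  have hΩint : ∀ b' : ℕ → ℤ, InPolytope b' → padicNorm p (omegaRes b' p) ≤ 1 := fun b' hb'' =>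
    padicNorm_omegaRes_le_one b' hb'' (by omega)
  apply val_ge_of_padicNorm_le hcas
  rw [casoratian_split b j p]
  by_cases hpd : (p : ℤ) ≤ dOf b
  · rw [omegaRes_eq_zero b hb (by omega), omegaRes_eq_zero (shift b j) hb' (by rw [hdshift]; omega), zero_mul, zero_mul,
      sub_zero, zero_sub, padicNorm.neg]
    refine hBb.trans (zpow_le_zpow_right₀ hp1.le ?_)
    have : refund b p ≤ 1 := min_le_left _ _
    linarith
  · have hr : refund b p = 0 := by
      unfold refund
      rw [Int.ediv_eq_zero_of_lt hd0 (by omega)]; simp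
    rw [hr, zero_sub, neg_neg]
    refine (padicNorm.sub (p := p)).trans (max_le ((padicNorm.sub (p := p)).trans (max_le ?_ ?_)) ?_)
    · rw [padicNorm.mul]
      calc padicNorm p (omegaRes (shift b j) p) * padicNorm p (coeffV b) ≤ 1 * (p : ℚ) ^ pairFloors b p :=
            mul_le_mul (hΩint _ hb') hVb (padicNorm.nonneg _) zero_le_one
        _ = _ := one_mul _
    · rw [padicNorm.mul]
      calc padicNorm p (omegaRes b p) * padicNorm p (coeffV (shift b j)) ≤ 1 * (p : ℚ) ^ pairFloors b p :=
            mul_le_mul (hΩint _ hb) hVb' (padicNorm.nonneg _) zero_le_one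
        _ = _ := one_mul _
    · exact hBb.trans (zpow_le_zpow_right₀ hp1.le (by linarith))

end Summit.KontsevichZagierPeriods.Zeta5Search.ClusterValuation

end
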